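import Summits.QuantumFields.YangMills.Theorems.LangevinControlUVFemtoCurvatureSkewnessCRatioTransportDefs

/-!
# Route `LangevinControlUV`, crux `FemtoCurvatureSkewnessC` (stmt-QuantumFields-16205), line `ratio-transport`: stub A in semiclassical shape

Lead `prover-line-stmt-QuantumFields-16205-0` (2026-08-16), companion (B) of the route-posited vocabulary file
`LangevinControlUVFemtoCurvatureSkewnessCRatioTransportDefs.lean`.

The line's only signed input, stub A `Anchors` / `FixedTorusAnchors r` (a uniform eventual floor `u₀` of the tree-normalised
skewness ratio `skewRatioT r L₀ β n₀` as `β → ∞` on every fixed torus), is here restated in the standard SEMICLASSICAL-LIMIT shape in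
which fixed-torus weak-coupling statements are proved and consumed elsewhere in the tree (`eventually_ne_zero_of_leadingOrder`,
`GenericStepGammaEncoding.SemiclassicalLimits`): `FixedTorusLeadingOrder r` — on every fixed torus `β² · Cov_axis → T₂ > 0` and
`β³ · κ₃ → T₃`, with the limiting ratio `T₃ G_a / (T₂^{3/2} G_d)` bounded below by one `u₀ > 0` (tree level: `T₂ = 2dλ²G_a²`,
`T₃ = 8dλ³G_a²G_d`, ratio `2^{3/2}d^{-1/2}` exactly) — and the elementary implication
`fixedTorusAnchors_of_leadingOrder : FixedTorusLeadingOrder r → FixedTorusAnchors r` is PROVED (limit algebra: for `β > 0` and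
`Cov > 0`, `u = (β³κ₃)·G_a / ((β²Cov)^{3/2}·G_d)`).  So whoever proves the fixed-torus Laplace asymptotics WITH VALUE (the
worker verdict on stub A: no Literature / tree fact states it yet) closes stub A through this lemma.  Route-posited `def`, nothing
asserted.
-/

set_option autoImplicit false

noncomputable section

namespace Summit.QuantumFields.YangMills.Cruxes.FemtoCurvatureSkewnessC.RatioTransport

open MeasureTheory Filter Topology
open Literature.MathematicalPhysics.QuantumFieldTheory
open Summit.QuantumFields.YangMills.Theorems.FemtoCurvatureSkewness.Negative (kappa3 TwoPointPackage)
open Summit.QuantumFields.YangMills.Cruxes.FemtoCurvatureSkewness.CouplingCubicResponse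
  (covAxis torusPropAxis torusPropDiag torusPropAxis_pos torusPropDiag_pos)

section LeadingOrder

variable {G : Type} [Group G] [TopologicalSpace G] [IsTopologicalGroup G] [CompactSpace G]
  [MeasurableSpace G] [BorelSpace G]

/-- **Fixed-torus leading-order asymptotics WITH VALUE** (stub A in semiclassical shape): one `u₀ > 0` such that on every fixed
torus `L₀ ≥ 8n₀`, `n₀ ≥ 1`, the rescaled axis covariance `β²·Cov` and cumulant `β³·κ₃` converge as `β → ∞`, the covariance
limit is positive, and the limiting tree-normalised ratio `T₃·G_a / (T₂^{3/2}·G_d)` is at least `u₀`. -/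
def FixedTorusLeadingOrder (r : LatticeRep G) : Prop :=
  ∃ u₀ : ℝ, 0 < u₀ ∧ ∀ (L₀ n₀ : ℕ) [NeZero L₀], 1 ≤ n₀ → 8 * n₀ ≤ L₀ →
    ∃ T₂ T₃ : ℝ, 0 < T₂ ∧ u₀ ≤ T₃ * torusPropAxis L₀ n₀ / (T₂ ^ (3 / 2 : ℝ) * torusPropDiag L₀ n₀) ∧
      Tendsto (fun β : ℝ => β ^ 2 * covAxis r L₀ β n₀) atTop (𝓝 T₂) ∧
      Tendsto (fun β : ℝ => β ^ 3 * kappa3 r L₀ β n₀) atTop (𝓝 T₃)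

/-- For `β > 0` and `Cov ≥ 0` the ratio is scale-free: `κ₃·G_a/(Cov^{3/2}·G_d) = (β³κ₃)·G_a/((β²Cov)^{3/2}·G_d)`. -/
theorem skewRatioT_eq_rescaled (r : LatticeRep G) (L : ℕ) [NeZero L] {β : ℝ} (hβ : 0 < β) (n : ℕ)
    (hC : 0 ≤ covAxis r L β n) :
    skewRatioT r L β n = β ^ 3 * kappa3 r L β n * torusPropAxis L n /
      ((β ^ 2 * covAxis r L β n) ^ (3 / 2 : ℝ) * torusPropDiag L n) := by
  unfold skewRatioT
  have hβ2 : (β ^ 2) ^ (3 / 2 : ℝ) = β ^ 3 := by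
    rw [show (β ^ 2 : ℝ) = β ^ (2 : ℝ) by norm_cast, ← Real.rpow_mul hβ.le]
    norm_num
  rw [Real.mul_rpow (sq_nonneg β) hC, hβ2]
  have hβ3 : (β ^ 3 : ℝ) ≠ 0 := pow_ne_zero 3 hβ.ne'
  rw [mul_assoc (β ^ 3) (covAxis r L β n ^ (3 / 2 : ℝ)), mul_assoc (β ^ 3) (kappa3 r L β n),
    mul_div_mul_left _ _ hβ3]

/-- **Stub A in semiclassical shape ⇒ stub A**: fixed-torus leading-order asymptotics with value give the fixed-torus anchors
(with anchor constant `u₀/2`). -/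
theorem fixedTorusAnchors_of_leadingOrder (r : LatticeRep G) (h : FixedTorusLeadingOrder r) :
    FixedTorusAnchors r := by
  obtain ⟨u₀, hu₀, hLO⟩ := h
  refine ⟨u₀ / 2, by positivity, ?_⟩
  intro L₀ n₀ _ hn h8
  obtain ⟨T₂, T₃, hT₂, hratio, hCov, hK⟩ := hLO L₀ n₀ hn h8
  have hA : 0 < torusPropAxis L₀ n₀ := torusPropAxis_pos L₀ n₀ hn h8
  have hD : 0 < torusPropDiag L₀ n₀ := torusPropDiag_pos L₀ n₀ hn h8
  -- the rescaled ratio converges to the limiting ratio `ℓ ≥ u₀`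
  set ℓ : ℝ := T₃ * torusPropAxis L₀ n₀ / (T₂ ^ (3 / 2 : ℝ) * torusPropDiag L₀ n₀) with hℓ
  have hden : T₂ ^ (3 / 2 : ℝ) * torusPropDiag L₀ n₀ ≠ 0 :=
    mul_ne_zero (Real.rpow_pos_of_pos hT₂ _).ne' hD.ne'
  have hlim : Tendsto (fun β : ℝ => β ^ 3 * kappa3 r L₀ β n₀ * torusPropAxis L₀ n₀ /
      ((β ^ 2 * covAxis r L₀ β n₀) ^ (3 / 2 : ℝ) * torusPropDiag L₀ n₀)) atTop (𝓝 ℓ) := by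
    apply Tendsto.div (hK.mul_const _) _ hden
    exact (hCov.rpow_const (Or.inl hT₂.ne')).mul_const _
  -- eventually `β > 0` and `Cov > 0`, where the ratio IS the rescaled ratio
  have hCpos : ∀ᶠ β : ℝ in atTop, 0 < β ^ 2 * covAxis r L₀ β n₀ :=
    hCov.eventually (lt_mem_nhds hT₂)
  have hβpos : ∀ᶠ β : ℝ in atTop, 0 < β := eventually_gt_atTop 0
  have heq : ∀ᶠ β : ℝ in atTop, β ^ 3 * kappa3 r L₀ β n₀ * torusPropAxis L₀ n₀ /
      ((β ^ 2 * covAxis r L₀ β n₀) ^ (3 / 2 : ℝ) * torusPropDiag L₀ n₀) = skewRatioT r L₀ β n₀ := by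
    filter_upwards [hCpos, hβpos] with β hC hβ
    have hC' : 0 ≤ covAxis r L₀ β n₀ := (pos_of_mul_pos_right hC (sq_nonneg β)).le
    exact (skewRatioT_eq_rescaled r L₀ hβ n₀ hC').symm
  have hlim' : Tendsto (fun β : ℝ => skewRatioT r L₀ β n₀) atTop (𝓝 ℓ) := hlim.congr' heq
  have hℓ' : u₀ / 2 < ℓ := by rw [hℓ]; linarith
  exact ((tendsto_order.1 hlim').1 _ hℓ').mono fun β hβ => hβ.le

end LeadingOrder

/-- **The anchors in semiclassical shape, all `(G, r)` at which the crux hypothesis holds.** -/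
def AnchorsLeadingOrder : Prop :=
  ∀ (G : Type) [Group G] [TopologicalSpace G] [IsTopologicalGroup G] [CompactSpace G]
    [MeasurableSpace G] [BorelSpace G], IsCompactSimpleLieGroup G →
    ∀ (r : LatticeRep G), (∃ a : ℝ → ℝ, Continuous a ∧ TwoPointPackage r a) → FixedTorusLeadingOrder r

/-- Semiclassical anchors ⇒ stub A (`Anchors`). -/
theorem anchors_of_leadingOrder (h : AnchorsLeadingOrder) : Anchors := by
  intro G _ _ _ _ _ _ hG r hex
  exact fixedTorusAnchors_of_leadingOrder r (h G hG r hex)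

end Summit.QuantumFields.YangMills.Cruxes.FemtoCurvatureSkewnessC.RatioTransport

end
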